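import Literature.MathematicalPhysics.QuantumFieldTheory.Balaban1983to89.B11Eq174Chart

/-!
# `Balaban1983to89.B11Eq115Space` — T. Bałaban, *The variational problem and background fields in renormalization group
# method for lattice gauge theories*, Commun. Math. Phys. **102** (1985) 277–309 [Balaban1985Variational]: THE SPACE (115)
# «max{|A₁|_{(−1)}, |∇A₁|_{(−2)}} < ε₄» (p. 294) and the sizes |·|_{(−n)} = sup_j (L^jη)^n sup_{Ω_j}|·| (p. 286) AS GENUINE
# (complex) NORMED SPACES on function carriers — the concrete `𝒴`, `𝒵` over which the contraction scheme of Sects. E–G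
# (`B11Prop6Scheme`, `B11Eq174Chart`) is so far typed only abstractly

statement-level skeleton of published theorems with citation tags; proofs where landed; nothing here is a claim
about the Yang–Mills mass gap

PDF held: `paper:balaban1985-cmp102-variational-background` (journal page = PDF page + 276); pp. 286 (PDF 10), 290 (PDF 14),
292–296 (PDF 16–20) read from the held text by this seat (`lit read`, 2026-08-21).

THE PRINT (verbatim).  p. 286: *«… so we can take it arbitrarily close to sup_j L^jη sup_{Ω_j}|A′| = |A′|_{(−1)}»* — the
definition of the size |·|_{(−1)}; the sizes |·|_{(−2)}, |·|_{(−3)} are used in the same sense ((98), (117), (120), (130)).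
p. 290 (77): *«|A′| < ε₃(L^jη)^{−1}, |∇A′| < ε₃(L^jη)^{−2} on Ω_j, j = 0, 1, …, k»*; p. 292, Proposition 4: *«… satisfying the
inequalities (77), i.e. max{|A′|_{(−1)}, |∇A′|_{(−2)}} < ε₃»*; p. 293 (98): *«|(δ/δA′)V(A′)|_{(−3)} ≤ C₄(max{|A′|_{(−1)},
|∇A′|_{(−2)}})², and it is valid if max{|A′|_{(−1)}, |∇A′|_{(−2)}} ≤ a₃»*; p. 293 (103)–(104): *«|H₁B| < B₀2dLC₁ε₁(L^jη)^{−1},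
|∇H₁B| < B₀2dLC₁ε₁(L^jη)^{−2} on Ω_j … |A₁| < 2ε₃(L^jη)^{−1}, |∇A₁| < 2ε₃(L^jη)^{−2} on Ω_j»*; p. 294 (115): *«Let us
consider this equation for configurations A₁ in the space |A₁| < ε₄(L^jη)^{−1}, |∇A₁| < ε₄(L^jη)^{−2} on Ω_j, i.e.
max{|A₁|_{(−1)}, |∇A₁|_{(−2)}} < ε₄. (115)»*; p. 295: *«By Theorem 3.13 of [5] the norm max{|·|_{(−1)}, |∇·|_{(−2)}} of the
transformation can be estimated by B₀|J|_{(−3)} + B₀|((δ/δA′)V)(A₁ + H₁B)|_{(−3)} (117)»*.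

WHY THIS FILE (cell context).  The whole of Sects. E–G is kernel-checked in the tree over ABSTRACT complex Banach spaces `𝒴`
(«whose norm stands for max{|·|_{(−1)}, |∇·|_{(−2)}}») and `𝒵` («|·|_{(−3)}»): `B11Prop6Scheme` ((116)–(121), Prop. 6),
`B11Eq174Chart` (`solA`, `Regime`, the chart (174)), `B11Prop6Model` (header (M1): *«On the finite lattices of the paper these
spaces are finite-dimensional»*), and on the consumer side `pub-balaban`'s NE9 END through
`Summits/…/NE9B11ChartAnalytic.chartHB_triple_of_twoRegimes`.  The tree ALSO types (115) and the sizes BY NAME, ℝ-valued and block-LOCALISED, as `B11SectG.BlockNorm`s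
— `B11KernelDictionary.weightedBlocks` / `loc_le_iff` (the «i.e.», `≤` form, per block) / `jet` / `jetSize` / `loc_jet_eq_max` /
`negSize` (weight `g.len (blk x) ^ n`) / `jetNegSize`, and the sup devices `B11SupSize190.supNorm`, `B11SeminormSize190.ofSeminorms` —
NOT as normed spaces; nothing of them is re-declared here.  THE DELTA of this file: the GLOBAL size as a GENUINE norm (Mathlib
`NormedAddCommGroup` / `NormedSpace ℂ` / `FiniteDimensional` / `CompleteSpace` INSTANCES on a type synonym), the STRICT «i.e.» (the open
ball of (115), which `B11Prop6Scheme` distinguishes from the closed selection ball), and instantiable `𝒴` / `𝒵` for `B11Eq174Chart`.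
None of the files above has a CONCRETE normed carrier to be instantiated at: the letter (L1) of the NE9 letter map (lit-balaban `INTERFACES.md` §3, NEED-3; pub-balaban supply
`t4/b2b-balaban-t4-ne9-p1/g75/SPINE-SURGE-SUPPLY-NE9-OWNER.md` §3).  THIS FILE supplies it: the printed sizes as Mathlib
`NormedAddCommGroup` / `NormedSpace` structures on functions `ι → V`, so that `Regime 𝒢 Λ W …`, `solA`, `chartHB` ELABORATE at
`𝒴 := Space115 …`, `𝒵 := NegSize … 3 V` (§4 checks this), and the operators (L2) 𝔊, (L3) (δ/δA′)V, (L4) H, (L6) H₁ of the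
letter map can be TYPED as (continuous linear / analytic) maps between concrete spaces.

WHAT IS DEFINED AND PROVED (Mathlib only, plus `B11Eq174Chart` for §4; sorry-free; no `Prop` placeholder, no new fact).
* §1 `NegSup w V` — the type synonym of `ι → V` (`ι` a finite index, `V` any normed group / normed `𝕜`-space) normed by the
  WEIGHTED SUP `‖f‖ = sup_x w(x)·‖f(x)‖` for a positive weight `w` (positivity carried by `Fact (∀ x, 0 < w x)`): instances
  `NormedAddCommGroup` (from an `AddGroupNorm`), `NormedSpace 𝕜`, `FiniteDimensional`, `CompleteSpace`; the reading lemmas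
  `norm_le_iff` / `norm_lt_iff` (‖f‖ ≤ r ⟺ w(x)‖f(x)‖ ≤ r at every point — the printed *«i.e.»*), `weight_mul_norm_apply_le`,
  `norm_apply_le`; the equivalence with the flat sup norm (`norm_le_wSup_mul`, `sup_norm_le_wInvSup_mul`, constants
  `W⁺ = max w`, `W⁻ = max w⁻¹`; `lipschitzWith_equiv`, `antilipschitzWith_equiv`, `uniformEquiv`, `continuousLinearEquiv`);
  evaluation as a continuous linear map (`evalCLM`).
* §2 `JetSup w₀ w₁ ∇` — the type synonym of `ι → V` normed by `max{‖f‖_{w₀}, ‖∇f‖_{w₁}}` for a LINEAR `∇ : (ι → V) →ₗ[𝕜] (κ → V)`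
  (the jet norm): the same instances (`CompleteSpace` for finite-dimensional fibres over a complete field, which is every
  lattice space of the paper), `fst`/`snd` (= `f` and `∇f` in their weighted sup spaces, as continuous linear maps `fstCLM`,
  `sndCLM` of norm ≤ 1), `norm_le_iff_pointwise` / `norm_lt_iff_pointwise`.
* §3 THE PRINTED LETTERS: `levWeight L η lev n x = (L^{j(x)}η)^n` for a level map `j : ι → ℕ`; `NegSize L η lev n V` = the size
  |·|_{(−n)}; `Space115 L η lev₀ lev₁ ∇` = the space (115); `mem_ball115_iff` (**(115) verbatim**: the `ε₄`-ball of the space IS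
  the set «|A₁| < ε₄(L^jη)^{−1}, |∇A₁| < ε₄(L^jη)^{−2}»), `mem_ballNeg_iff` (the same for |·|_{(−n)}: (28), (97), (103));
  `levOf Ω k x` = the level of a point for a domain sequence `Ω₀ = T, …, Ω_k` (largest `j ≤ k` with `x ∈ Ω_j`) and
  **`norm_le_iff_levels` / `norm_lt_iff_levels`**: with `lev := levOf Ω k` the weighted sup IS print's
  *«sup_j (L^jη)^n sup_{Ω_j}|f|»* (p. 286) — `‖f‖ ≤ r ⟺ ∀ j ≤ k, ∀ x ∈ Ω_j, (L^jη)^n|f(x)| ≤ r` (`1 ≤ L`).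
* §4 `solA115` = `B11Eq174Chart.solA` AT `𝒴 := Space115 …`, `𝒵 := NegSize … 3 V` over `ℂ`, `chartHB115` = `B11Eq174Chart.chartHB`
  there with the block fields in `𝒳 := NegSize … 0 V` (the instance checks that the scheme and the chart accept the concrete
  carriers), `chartHB115_zero` («𝓗(0) = 0» specialised) and `solA115_pointwise`: Proposition 6's *«This solution satisfies the
  bounds (115)»* READ ON THE LATTICE — under a `Regime`, `L^{j(x)}η|𝒜(x)| ≤ ε₄` and `(L^{j(p)}η)²|(∇𝒜)(p)| ≤ ε₄` pointwise.

MODEL / DECLARED READINGS.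
 (M1) INDEX AND FIBRE are PARAMETERS: `ι` = the points of `A′` (print: the bonds of `Ω₀ ⊂ T_η`, positively oriented; e.g. the tree's
      `B9SectCLatticeCarrier.Bond d Pd` on the periodic lattice, or the `ℤ^d` bonds of `B11Eq7Convention` restricted to a finite
      window), `κ` = the points of `∇A′` (pairs (bond, direction)), `V` = the fibre (print: the complexified Lie algebra 𝔤ᶜ with
      |·| its norm; e.g. `Matrix (Fin N) (Fin N) ℂ` or the tree's `T4AdjointCovarianceUnitary.lieU`); finiteness of `ι`, `κ` is
      print's finite lattice.
 (M2) THE DERIVATIVE `∇` IS A PARAMETER `(ι → V) →ₗ[𝕜] (κ → V)`: print's ∇ in (77)/(115) is the covariant derivative `∇^{U₀}` of the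
      background ([6] (1.x), [5] (3.3); scalar reading in the tree: `B9SectCLatticeCarrier.sT`/`sJ`); this file does not
      construct it (letter (L1′) of the map: the 𝔤ᶜ-valued covariant lattice derivative as a linear map), so `Space115 … ∇` is a
      FAMILY of normed spaces indexed by that datum, as print's space (115) depends on U₀.
 (M3) THE LEVEL MAP: print weights a point of `Ω_j` by `(L^jη)^n` and takes `sup_j sup_{Ω_j}`; for `L ≥ 1` this is the weight
      `(L^{j(x)}η)^n` at the largest `j` with `x ∈ Ω_j` (`levOf`; `norm_le_iff_levels` proves the identification, no nesting of the
      `Ω_j` needed) — the level is the POINT's (`x ∈ Λ_{j(x)}`, p. 286), supplied as a map `lev : ι → ℕ`; a BLOCK's level (the tree's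
      `g.len ∘ blk` in `B11KernelDictionary.negSize`) is the special case `lev := level ∘ blk`.  `L`, `η = L^{−k}` are real PARAMETERS
      with `0 < L`, `0 < η` as `Fact`s; STRICT positivity of the weight (not `0 ≤`) is what makes the size a norm (definiteness); on an
      EMPTY index the space is `{0}` (‖f‖ = 0; `norm_lt_iff` then reads `0 < r ↔ True`, `norm_le_iff` keeps its `0 ≤ r` guard).
 (M4) STRICT VS CLOSED BALLS: (115) is an OPEN condition; `B11Eq174Chart.solA` selects in the CLOSED ball `‖X‖ ≤ ε₄` (its (M)-reading);
      §4 states the closed form, `mem_ball115_iff` the open one.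
HONEST SCOPE.  Functional-analysis bookkeeping ([folklore]) realising three printed SIZES as normed spaces; NO operator of the
paper (𝔊, H, H₁, (δ/δA′)V, ∇^{U₀}, Q, D) is constructed and NO inequality of the paper is proved; Proposition 6 / Theorem 3.13 [5] /
Proposition 4 remain the hypotheses of `B11Eq174Chart.Regime`.  Nothing here is progress on the summit `Summit.QuantumFields`
(cell pub-balaban: NE9 NOT PRINTED / NOT PROVED; spine PROVED 0/9).  Filed by the pub-balaban NE9 BINDER-row owner lineage
`b2b-balaban-t4-ne9-p1` (gen 76) as letter (L1) of lit-balaban `INTERFACES.md` §3 NEED-3 — a NEW file; no lit-balaban file is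
modified.  Net new unproved facts: 0.
-/

noncomputable section

open scoped NNReal
open Finset Metric

namespace Literature.MathematicalPhysics.QuantumFieldTheory.Balaban1983to89.B11Eq115Space

/-! ## §1 The weighted sup spaces `|·|_w` (carriers of the sizes |·|_{(−n)}) -/

section NegSup

variable {ι : Type*}

/-- The carrier of the weighted sup size `|·|_w` (print's |·|_{(−n)} for `w = (L^jη)^n`): functions `ι → V` (a type synonym — `def`, not
`abbrev`, so that the bare Pi type keeps Mathlib's unweighted sup norm; the weighted norm is registered below).  The tree's block-LOCALISED
ℝ-valued reading of the same size is `B11KernelDictionary.weightedBlocks` / `negSize` (a `B11SectG.BlockNorm`, not a normed space); this is the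
GLOBAL size as a norm. [cite: Balaban1985Variational, p.286] -/
def NegSup (_w : ι → ℝ) (V : Type*) : Type _ := ι → V

namespace NegSup

variable {w : ι → ℝ} {V : Type*}

/-- The identification with plain functions. [folklore] -/
protected def equiv (w : ι → ℝ) (V : Type*) : NegSup w V ≃ (ι → V) := Equiv.refl _

/-- The additive group structure of the carrier (that of `ι → V`). [folklore] -/
instance [AddCommGroup V] : AddCommGroup (NegSup w V) := inferInstanceAs (AddCommGroup (ι → V))

/-- The module structure of the carrier (that of `ι → V`). [folklore] -/
instance {𝕜 : Type*} [Semiring 𝕜] [AddCommGroup V] [Module 𝕜 V] : Module 𝕜 (NegSup w V) :=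
  inferInstanceAs (Module 𝕜 (ι → V))

/-- The carrier is inhabited. [folklore] -/
instance [Inhabited V] : Inhabited (NegSup w V) := inferInstanceAs (Inhabited (ι → V))

/-- Evaluation at a point (through the identification). [cite: Balaban1985Variational, p.286] -/
theorem equiv_apply (f : NegSup w V) (i : ι) : NegSup.equiv w V f i = f i := rfl

/-- The identification is additive. [cite: Balaban1985Variational, p.286] -/
@[simp] theorem equiv_add [AddCommGroup V] (f g : NegSup w V) :
    NegSup.equiv w V (f + g) = NegSup.equiv w V f + NegSup.equiv w V g := rfl

/-- The identification commutes with negation. [cite: Balaban1985Variational, p.286] -/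
@[simp] theorem equiv_neg [AddCommGroup V] (f : NegSup w V) :
    NegSup.equiv w V (-f) = -NegSup.equiv w V f := rfl

/-- The identification commutes with subtraction. [cite: Balaban1985Variational, p.286] -/
@[simp] theorem equiv_sub [AddCommGroup V] (f g : NegSup w V) :
    NegSup.equiv w V (f - g) = NegSup.equiv w V f - NegSup.equiv w V g := rfl

/-- The identification maps `0` to `0`. [cite: Balaban1985Variational, p.286] -/
@[simp] theorem equiv_zero [AddCommGroup V] : NegSup.equiv w V 0 = 0 := rfl

/-- The identification commutes with scalars. [cite: Balaban1985Variational, p.286] -/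
@[simp] theorem equiv_smul {𝕜 : Type*} [Semiring 𝕜] [AddCommGroup V] [Module 𝕜 V] (c : 𝕜) (f : NegSup w V) :
    NegSup.equiv w V (c • f) = c • NegSup.equiv w V f := rfl

/-- Evaluation of a function read in the carrier. [cite: Balaban1985Variational, p.286] -/
@[simp] theorem equiv_symm_apply (f : ι → V) (i : ι) : (NegSup.equiv w V).symm f i = f i := rfl

/-- The identification as a linear equivalence. [folklore] -/
protected def linearEquiv (𝕜 : Type*) [Semiring 𝕜] [AddCommGroup V] [Module 𝕜 V] (w : ι → ℝ) :
    NegSup w V ≃ₗ[𝕜] (ι → V) :=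
  { NegSup.equiv w V with
    map_add' := fun _ _ => rfl
    map_smul' := fun _ _ => rfl }

/-- The linear identification is the identification. [cite: Balaban1985Variational, p.286] -/
@[simp] theorem linearEquiv_apply {𝕜 : Type*} [Semiring 𝕜] [AddCommGroup V] [Module 𝕜 V] (f : NegSup w V) :
    NegSup.linearEquiv 𝕜 w f = NegSup.equiv w V f := rfl

variable [NormedAddCommGroup V]

/-- The weight profile `x ↦ w(x)·‖f(x)‖` of `f`, a real function on `ι` (read in the sup-normed space `ι → ℝ`). [folklore] -/
def profile (w : ι → ℝ) (f : NegSup w V) : ι → ℝ := fun i => w i * ‖NegSup.equiv w V f i‖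

/-- Unfolding the weight profile. [cite: Balaban1985Variational, p.286] -/
theorem profile_apply (f : NegSup w V) (i : ι) : profile w f i = w i * ‖NegSup.equiv w V f i‖ := rfl

/-- The weight profile is non-negative for non-negative weights. [cite: Balaban1985Variational, p.286] -/
theorem profile_nonneg (hw : ∀ i, 0 ≤ w i) (f : NegSup w V) (i : ι) : 0 ≤ profile w f i :=
  mul_nonneg (hw i) (norm_nonneg _)

/-- The entries of the weight profile are their own absolute values. [cite: Balaban1985Variational, p.286] -/
theorem norm_profile_apply (hw : ∀ i, 0 ≤ w i) (f : NegSup w V) (i : ι) :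
    ‖profile w f i‖ = w i * ‖NegSup.equiv w V f i‖ :=
  Real.norm_of_nonneg (profile_nonneg hw f i)

/-- The weight profile is subadditive (triangle inequality in the fibre). [cite: Balaban1985Variational, p.286] -/
theorem profile_add_le (hw : ∀ i, 0 ≤ w i) (f g : NegSup w V) (i : ι) :
    profile w (f + g) i ≤ profile w f i + profile w g i := by
  simp only [profile_apply, equiv_add, Pi.add_apply, ← mul_add]
  exact mul_le_mul_of_nonneg_left (norm_add_le _ _) (hw i)

/-- The weight profile is even. [cite: Balaban1985Variational, p.286] -/
theorem profile_neg (f : NegSup w V) : profile w (-f) = profile w f := by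
  funext i; simp only [profile_apply, equiv_neg, Pi.neg_apply, norm_neg]

/-- The weight profile of `0` vanishes. [cite: Balaban1985Variational, p.286] -/
theorem profile_zero : profile w (0 : NegSup w V) = 0 := by
  funext i; simp only [profile_apply, equiv_zero, Pi.zero_apply, norm_zero, mul_zero]

/-- The weight profile is absolutely homogeneous. [cite: Balaban1985Variational, p.286] -/
theorem profile_smul {𝕜 : Type*} [NormedField 𝕜] [NormedSpace 𝕜 V] (c : 𝕜) (f : NegSup w V) :
    profile w (c • f) = ‖c‖ • profile w f := by
  funext i; simp only [profile_apply, equiv_smul, Pi.smul_apply, norm_smul, smul_eq_mul]; ring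

/-- The weights as non-negative reals (positive weights, carried by `Fact`). [folklore] -/
def wNN (w : ι → ℝ) [Fact (∀ i, 0 < w i)] (i : ι) : ℝ≥0 := ⟨w i, ((Fact.out : ∀ i, 0 < w i) i).le⟩

/-- The non-negative weight is the weight. [cite: Balaban1985Variational, p.286] -/
@[simp] theorem coe_wNN [Fact (∀ i, 0 < w i)] (i : ι) : (wNN w i : ℝ) = w i := rfl

variable [Fintype ι]

/-- The weighted sup size `sup_x w(x)·‖f(x)‖` is an additive-group norm for POSITIVE weights. [folklore] -/
def addGroupNorm (hw : ∀ i, 0 < w i) : AddGroupNorm (NegSup w V) where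
  toFun f := ‖profile w f‖
  map_zero' := by rw [profile_zero, norm_zero]
  add_le' f g := by
    have h0 : ∀ i, 0 ≤ w i := fun i => (hw i).le
    rw [pi_norm_le_iff_of_nonneg (add_nonneg (norm_nonneg _) (norm_nonneg _))]
    intro i
    rw [Real.norm_of_nonneg (profile_nonneg h0 _ i)]
    refine (profile_add_le h0 f g i).trans (add_le_add ?_ ?_)
    · rw [← Real.norm_of_nonneg (profile_nonneg h0 f i)]; exact norm_le_pi_norm _ i
    · rw [← Real.norm_of_nonneg (profile_nonneg h0 g i)]; exact norm_le_pi_norm _ i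
  neg' f := by rw [profile_neg]
  eq_zero_of_map_eq_zero' f hf := by
    have h0 : ∀ i, 0 ≤ w i := fun i => (hw i).le
    have h := (pi_norm_le_iff_of_nonneg le_rfl).1 hf.le
    funext i
    have hi := h i
    rw [Real.norm_of_nonneg (profile_nonneg h0 f i), profile_apply] at hi
    have : ‖NegSup.equiv w V f i‖ ≤ 0 := by
      by_contra hne
      exact (not_le.2 (mul_pos (hw i) (not_le.1 hne))) hi
    exact norm_le_zero_iff.1 this

variable [Fact (∀ i, 0 < w i)]

/-- **`|·|_w` is a norm**: the `NormedAddCommGroup` structure of the weighted sup space `‖f‖ = sup_x w(x)·‖f(x)‖`. [folklore] -/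
instance instNormedAddCommGroup : NormedAddCommGroup (NegSup w V) := (addGroupNorm Fact.out).toNormedAddCommGroup

/-- **The norm of the carrier IS the weighted sup** `sup_x w(x)·‖f(x)‖` (the sup norm of the weight profile). [cite: Balaban1985Variational, p.286] -/
theorem norm_def (f : NegSup w V) : ‖f‖ = ‖profile w f‖ := rfl

/-- … and a normed `𝕜`-space for every normed field acting on the fibre (absolute homogeneity of the weighted sup). [folklore] -/
instance instNormedSpace {𝕜 : Type*} [NormedField 𝕜] [NormedSpace 𝕜 V] : NormedSpace 𝕜 (NegSup w V) where
  norm_smul_le c f := by rw [norm_def, norm_def, profile_smul, norm_smul, Real.norm_of_nonneg (norm_nonneg c)]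

/-- Finite-dimensional fibres give a finite-dimensional weighted sup space. [folklore] -/
instance instFiniteDimensional {𝕜 : Type*} [NormedField 𝕜] [NormedSpace 𝕜 V] [FiniteDimensional 𝕜 V] :
    FiniteDimensional 𝕜 (NegSup w V) :=
  inferInstanceAs (FiniteDimensional 𝕜 (ι → V))

/-- `w(x)·‖f(x)‖ ≤ ‖f‖_w`. [cite: Balaban1985Variational, p.286] -/
theorem weight_mul_norm_apply_le (f : NegSup w V) (i : ι) : w i * ‖NegSup.equiv w V f i‖ ≤ ‖f‖ := by
  rw [norm_def, ← norm_profile_apply (fun i => ((Fact.out : ∀ i, 0 < w i) i).le) f i]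
  exact norm_le_pi_norm (profile w f) i

/-- **The «i.e.» of (115)/(77), `≤` form**: `‖f‖_w ≤ r` iff `w(x)·‖f(x)‖ ≤ r` at every point (`0 ≤ r`). [cite: Balaban1985Variational, p.286] -/
theorem norm_le_iff {f : NegSup w V} {r : ℝ} (hr : 0 ≤ r) : ‖f‖ ≤ r ↔ ∀ i, w i * ‖NegSup.equiv w V f i‖ ≤ r := by
  rw [norm_def, pi_norm_le_iff_of_nonneg hr]
  exact forall_congr' fun i => by rw [norm_profile_apply (fun i => ((Fact.out : ∀ i, 0 < w i) i).le)]

/-- **The «i.e.» of (115)/(77), strict form**: `‖f‖_w < r` iff `w(x)·‖f(x)‖ < r` at every point (`0 < r`). [cite: Balaban1985Variational, p.286] -/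
theorem norm_lt_iff {f : NegSup w V} {r : ℝ} (hr : 0 < r) : ‖f‖ < r ↔ ∀ i, w i * ‖NegSup.equiv w V f i‖ < r := by
  rw [norm_def, pi_norm_lt_iff hr]
  exact forall_congr' fun i => by rw [norm_profile_apply (fun i => ((Fact.out : ∀ i, 0 < w i) i).le)]

/-- Pointwise reading: `‖f(x)‖ ≤ w(x)⁻¹·‖f‖_w`. [cite: Balaban1985Variational, p.286] -/
theorem norm_apply_le (f : NegSup w V) (i : ι) : ‖NegSup.equiv w V f i‖ ≤ (w i)⁻¹ * ‖f‖ := by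
  rw [le_inv_mul_iff₀ ((Fact.out : ∀ i, 0 < w i) i)]
  exact weight_mul_norm_apply_le f i

/-- A function given pointwise with `w(x)·‖f(x)‖ ≤ r` everywhere has `‖f‖_w ≤ r`. [cite: Balaban1985Variational, p.286] -/
theorem norm_symm_le_of_pointwise {f : ι → V} {r : ℝ} (hr : 0 ≤ r) (h : ∀ i, w i * ‖f i‖ ≤ r) :
    ‖(NegSup.equiv w V).symm f‖ ≤ r :=
  (norm_le_iff hr).2 h

/-- The largest weight `W⁺ = max_x w(x)` (`0` on an empty index). [folklore] -/
def wSup (w : ι → ℝ) [Fact (∀ i, 0 < w i)] : ℝ≥0 := univ.sup (wNN w)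

/-- The largest inverse weight `W⁻ = max_x w(x)⁻¹` (`0` on an empty index). [folklore] -/
def wInvSup (w : ι → ℝ) [Fact (∀ i, 0 < w i)] : ℝ≥0 := univ.sup fun i => (wNN w i)⁻¹

/-- Each weight is at most the largest weight. [cite: Balaban1985Variational, p.286] -/
theorem le_wSup (i : ι) : w i ≤ (wSup w : ℝ) := by
  have h : wNN w i ≤ wSup w := Finset.le_sup (f := wNN w) (mem_univ i)
  exact_mod_cast h

/-- Each inverse weight is at most the largest inverse weight. [cite: Balaban1985Variational, p.286] -/
theorem inv_le_wInvSup (i : ι) : (w i)⁻¹ ≤ (wInvSup w : ℝ) := by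
  have h : (wNN w i)⁻¹ ≤ wInvSup w := Finset.le_sup (f := fun i => (wNN w i)⁻¹) (mem_univ i)
  have h' : (((wNN w i)⁻¹ : ℝ≥0) : ℝ) ≤ (wInvSup w : ℝ) := NNReal.coe_le_coe.2 h
  simpa only [NNReal.coe_inv, coe_wNN] using h'

/-- `‖f‖_w ≤ W⁺ · ‖f‖_∞`. [cite: Balaban1985Variational, p.286] -/
theorem norm_le_wSup_mul (f : NegSup w V) : ‖f‖ ≤ wSup w * ‖NegSup.equiv w V f‖ := by
  rw [norm_le_iff (mul_nonneg (wSup w).coe_nonneg (norm_nonneg (NegSup.equiv w V f)))]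
  intro i
  exact mul_le_mul (le_wSup i) (norm_le_pi_norm (NegSup.equiv w V f) i) (norm_nonneg _) (wSup w).coe_nonneg

/-- `‖f‖_∞ ≤ W⁻ · ‖f‖_w`. [cite: Balaban1985Variational, p.286] -/
theorem sup_norm_le_wInvSup_mul (f : NegSup w V) : ‖NegSup.equiv w V f‖ ≤ wInvSup w * ‖f‖ := by
  refine (pi_norm_le_iff_of_nonneg (mul_nonneg (wInvSup w).coe_nonneg (norm_nonneg f))).2 fun i => ?_
  exact (norm_apply_le f i).trans (mul_le_mul_of_nonneg_right (inv_le_wInvSup i) (norm_nonneg f))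

/-- The identification with the flat sup space is Lipschitz … [cite: Balaban1985Variational, p.286] -/
theorem lipschitzWith_equiv : LipschitzWith (wInvSup w) (NegSup.equiv w V) := by
  refine LipschitzWith.of_dist_le_mul fun f g => ?_
  rw [dist_eq_norm, dist_eq_norm, ← equiv_sub]
  exact sup_norm_le_wInvSup_mul (f - g)

/-- … and so is its inverse: the two norms are equivalent (finite index). [cite: Balaban1985Variational, p.286] -/
theorem lipschitzWith_equiv_symm : LipschitzWith (wSup w) (NegSup.equiv w V).symm := by
  refine LipschitzWith.of_dist_le_mul fun f g => ?_
  rw [dist_eq_norm, dist_eq_norm]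
  have h := norm_le_wSup_mul ((NegSup.equiv w V).symm f - (NegSup.equiv w V).symm g)
  rwa [equiv_sub, Equiv.apply_symm_apply, Equiv.apply_symm_apply] at h

/-- The identification is anti-Lipschitz. [cite: Balaban1985Variational, p.286] -/
theorem antilipschitzWith_equiv : AntilipschitzWith (wSup w) (NegSup.equiv w V) := by
  refine AntilipschitzWith.of_le_mul_dist fun f g => ?_
  rw [dist_eq_norm, dist_eq_norm, ← equiv_sub]
  exact norm_le_wSup_mul (f - g)

/-- The identification as a uniform equivalence. [folklore] -/
def uniformEquiv (w : ι → ℝ) (V : Type*) [NormedAddCommGroup V] [Fact (∀ i, 0 < w i)] : NegSup w V ≃ᵤ (ι → V) where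
  toEquiv := NegSup.equiv w V
  uniformContinuous_toFun := (lipschitzWith_equiv).uniformContinuous
  uniformContinuous_invFun := (lipschitzWith_equiv_symm).uniformContinuous

/-- Complete fibres give a complete weighted sup space. [folklore] -/
instance instCompleteSpace [CompleteSpace V] : CompleteSpace (NegSup w V) :=
  (uniformEquiv w V).completeSpace_iff.2 inferInstance

/-- The identification as a CONTINUOUS linear equivalence (any normed field acting on the fibre). [folklore] -/
def continuousLinearEquiv (𝕜 : Type*) [NormedField 𝕜] [NormedSpace 𝕜 V] (w : ι → ℝ) [Fact (∀ i, 0 < w i)] :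
    NegSup w V ≃L[𝕜] (ι → V) :=
  { NegSup.linearEquiv 𝕜 w with
    continuous_toFun := (lipschitzWith_equiv).continuous
    continuous_invFun := (lipschitzWith_equiv_symm).continuous }

/-- The continuous linear identification is the identification. [cite: Balaban1985Variational, p.286] -/
@[simp] theorem continuousLinearEquiv_apply {𝕜 : Type*} [NormedField 𝕜] [NormedSpace 𝕜 V] (f : NegSup w V) :
    continuousLinearEquiv 𝕜 w f = NegSup.equiv w V f := rfl

/-- Evaluation at a point is a continuous linear map. [folklore] -/
def evalCLM (𝕜 : Type*) [NormedField 𝕜] [NormedSpace 𝕜 V] (w : ι → ℝ) [Fact (∀ i, 0 < w i)] (i : ι) :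
    NegSup w V →L[𝕜] V :=
  (ContinuousLinearMap.proj i).comp (continuousLinearEquiv 𝕜 w).toContinuousLinearMap

/-- Unfolding the evaluation map. [cite: Balaban1985Variational, p.286] -/
@[simp] theorem evalCLM_apply {𝕜 : Type*} [NormedField 𝕜] [NormedSpace 𝕜 V] (i : ι) (f : NegSup w V) :
    evalCLM 𝕜 w i f = NegSup.equiv w V f i := rfl

end NegSup

end NegSup

/-! ## §2 The jet spaces: `max{‖f‖_{w₀}, ‖∇f‖_{w₁}}` for a linear `∇` -/

section JetSup

variable {ι κ : Type*} {𝕜 : Type*} [NontriviallyNormedField 𝕜] {V : Type*} [NormedAddCommGroup V] [NormedSpace 𝕜 V]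

/-- The carrier of the jet size `max{|f|_{w₀}, |∇f|_{w₁}}`: functions `ι → V` (a type synonym; the norm, which depends on the
linear map `∇ : (ι → V) →ₗ[𝕜] (κ → V)` — a PARAMETER, no injectivity assumed —, is registered below) — print's space of (115)/(77); the
tree's block-localised ℝ-valued reading is `B11KernelDictionary.jet` / `jetSize` / `loc_jet_eq_max` / `jetNegSize`. [cite: Balaban1985Variational, (115) p.294] -/
def JetSup (_w₀ : ι → ℝ) (_w₁ : κ → ℝ) (_D : (ι → V) →ₗ[𝕜] (κ → V)) : Type _ := ι → V

namespace JetSup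

variable {w₀ : ι → ℝ} {w₁ : κ → ℝ} {D : (ι → V) →ₗ[𝕜] (κ → V)}

/-- The identification with plain functions. [folklore] -/
protected def equiv (w₀ : ι → ℝ) (w₁ : κ → ℝ) (D : (ι → V) →ₗ[𝕜] (κ → V)) : JetSup w₀ w₁ D ≃ (ι → V) := Equiv.refl _

/-- The additive group structure of the jet carrier (that of `ι → V`). [folklore] -/
instance : AddCommGroup (JetSup w₀ w₁ D) := inferInstanceAs (AddCommGroup (ι → V))

/-- The module structure of the jet carrier (that of `ι → V`). [folklore] -/
instance : Module 𝕜 (JetSup w₀ w₁ D) := inferInstanceAs (Module 𝕜 (ι → V))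

/-- The jet carrier is inhabited. [folklore] -/
instance : Inhabited (JetSup w₀ w₁ D) := ⟨(0 : ι → V)⟩

/-- The zeroth-order part: `f` read in `|·|_{w₀}`. [folklore] -/
def fst (f : JetSup w₀ w₁ D) : NegSup w₀ V := (NegSup.equiv w₀ V).symm (JetSup.equiv w₀ w₁ D f)

/-- The first-order part: `∇f` read in `|·|_{w₁}`. [folklore] -/
def snd (f : JetSup w₀ w₁ D) : NegSup w₁ V := (NegSup.equiv w₁ V).symm (D (JetSup.equiv w₀ w₁ D f))

/-- The zeroth-order part is the function. [cite: Balaban1985Variational, (115) p.294] -/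
theorem equiv_fst (f : JetSup w₀ w₁ D) : NegSup.equiv w₀ V (fst f) = JetSup.equiv w₀ w₁ D f := rfl

/-- The first-order part is `∇f`. [cite: Balaban1985Variational, (115) p.294] -/
theorem equiv_snd (f : JetSup w₀ w₁ D) : NegSup.equiv w₁ V (snd f) = D (JetSup.equiv w₀ w₁ D f) := rfl

/-- `fst` is additive. [cite: Balaban1985Variational, (115) p.294] -/
@[simp] theorem fst_add (f g : JetSup w₀ w₁ D) : fst (f + g) = fst f + fst g := rfl
/-- `fst` commutes with negation. [cite: Balaban1985Variational, (115) p.294] -/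
@[simp] theorem fst_neg (f : JetSup w₀ w₁ D) : fst (-f) = -fst f := rfl
/-- `fst` commutes with subtraction. [cite: Balaban1985Variational, (115) p.294] -/
@[simp] theorem fst_sub (f g : JetSup w₀ w₁ D) : fst (f - g) = fst f - fst g := rfl
/-- `fst 0 = 0`. [cite: Balaban1985Variational, (115) p.294] -/
@[simp] theorem fst_zero : fst (0 : JetSup w₀ w₁ D) = 0 := rfl
/-- `fst` commutes with scalars. [cite: Balaban1985Variational, (115) p.294] -/
@[simp] theorem fst_smul (c : 𝕜) (f : JetSup w₀ w₁ D) : fst (c • f) = c • fst f := rfl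
/-- `snd` is additive (linearity of `∇`). [cite: Balaban1985Variational, (115) p.294] -/
@[simp] theorem snd_add (f g : JetSup w₀ w₁ D) : snd (f + g) = snd f + snd g := D.map_add _ _
/-- `snd` commutes with negation. [cite: Balaban1985Variational, (115) p.294] -/
@[simp] theorem snd_neg (f : JetSup w₀ w₁ D) : snd (-f) = -snd f := D.map_neg _
/-- `snd` commutes with subtraction. [cite: Balaban1985Variational, (115) p.294] -/
@[simp] theorem snd_sub (f g : JetSup w₀ w₁ D) : snd (f - g) = snd f - snd g := D.map_sub _ _
/-- `snd 0 = 0`. [cite: Balaban1985Variational, (115) p.294] -/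
@[simp] theorem snd_zero : snd (0 : JetSup w₀ w₁ D) = 0 := D.map_zero
/-- `snd` commutes with scalars. [cite: Balaban1985Variational, (115) p.294] -/
@[simp] theorem snd_smul (c : 𝕜) (f : JetSup w₀ w₁ D) : snd (c • f) = c • snd f := D.map_smul _ _

/-- The identification is additive. [cite: Balaban1985Variational, (115) p.294] -/
@[simp] theorem equiv_add (f g : JetSup w₀ w₁ D) :
    JetSup.equiv w₀ w₁ D (f + g) = JetSup.equiv w₀ w₁ D f + JetSup.equiv w₀ w₁ D g := rfl
/-- The identification commutes with subtraction. [cite: Balaban1985Variational, (115) p.294] -/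
@[simp] theorem equiv_sub (f g : JetSup w₀ w₁ D) :
    JetSup.equiv w₀ w₁ D (f - g) = JetSup.equiv w₀ w₁ D f - JetSup.equiv w₀ w₁ D g := rfl
/-- The identification commutes with scalars. [cite: Balaban1985Variational, (115) p.294] -/
@[simp] theorem equiv_smul (c : 𝕜) (f : JetSup w₀ w₁ D) : JetSup.equiv w₀ w₁ D (c • f) = c • JetSup.equiv w₀ w₁ D f := rfl
/-- The identification maps `0` to `0`. [cite: Balaban1985Variational, (115) p.294] -/
@[simp] theorem equiv_zero : JetSup.equiv w₀ w₁ D 0 = 0 := rfl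

variable [Fintype ι] [Fintype κ] [Fact (∀ i, 0 < w₀ i)] [Fact (∀ k, 0 < w₁ k)]

/-- The jet size `max{‖f‖_{w₀}, ‖∇f‖_{w₁}}` is an additive-group norm (definiteness from the zeroth-order part). [folklore] -/
def addGroupNorm (w₀ : ι → ℝ) (w₁ : κ → ℝ) (D : (ι → V) →ₗ[𝕜] (κ → V)) [Fact (∀ i, 0 < w₀ i)] [Fact (∀ k, 0 < w₁ k)] :
    AddGroupNorm (JetSup w₀ w₁ D) where
  toFun f := max ‖fst f‖ ‖snd f‖
  map_zero' := by rw [fst_zero, snd_zero, norm_zero, norm_zero, max_self]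
  add_le' f g := by
    rw [fst_add, snd_add]
    exact max_le ((norm_add_le _ _).trans (add_le_add (le_max_left _ _) (le_max_left _ _)))
      ((norm_add_le _ _).trans (add_le_add (le_max_right _ _) (le_max_right _ _)))
  neg' f := by rw [fst_neg, snd_neg, norm_neg, norm_neg]
  eq_zero_of_map_eq_zero' f hf := by
    have h0 : ‖fst f‖ ≤ 0 := (le_max_left _ _).trans hf.le
    have : fst f = 0 := norm_le_zero_iff.1 h0
    exact this

/-- **The space (115) is a normed group** (`max` of two norms pulled back along `id` and the linear `∇`; definite by the first). [folklore] -/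
instance instNormedAddCommGroup : NormedAddCommGroup (JetSup w₀ w₁ D) := (addGroupNorm w₀ w₁ D).toNormedAddCommGroup

/-- **The norm of the jet carrier IS** `max{‖f‖_{w₀}, ‖∇f‖_{w₁}}` — print's *«max{|A₁|_{(−1)}, |∇A₁|_{(−2)}}»*. [cite: Balaban1985Variational, (115) p.294] -/
theorem norm_def (f : JetSup w₀ w₁ D) : ‖f‖ = max ‖fst f‖ ‖snd f‖ := rfl

/-- … and a normed `𝕜`-space. [folklore] -/
instance instNormedSpace : NormedSpace 𝕜 (JetSup w₀ w₁ D) where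
  norm_smul_le c f := by
    rw [norm_def, norm_def, fst_smul, snd_smul, norm_smul, norm_smul, mul_max_of_nonneg _ _ (norm_nonneg c)]

/-- Finite-dimensional fibres give a finite-dimensional jet space. [folklore] -/
instance instFiniteDimensional [FiniteDimensional 𝕜 V] : FiniteDimensional 𝕜 (JetSup w₀ w₁ D) :=
  inferInstanceAs (FiniteDimensional 𝕜 (ι → V))

/-- Complete, when the fibre is finite-dimensional over a complete field (every lattice space of the paper: finite lattice,
`V = 𝔤ᶜ`). [folklore] -/
instance instCompleteSpace [CompleteSpace 𝕜] [FiniteDimensional 𝕜 V] : CompleteSpace (JetSup w₀ w₁ D) :=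
  FiniteDimensional.complete 𝕜 _

/-- `‖f‖_{w₀} ≤ ‖f‖`. [cite: Balaban1985Variational, (115) p.294] -/
theorem norm_fst_le (f : JetSup w₀ w₁ D) : ‖fst f‖ ≤ ‖f‖ := le_max_left _ _

/-- `‖∇f‖_{w₁} ≤ ‖f‖`. [cite: Balaban1985Variational, (115) p.294] -/
theorem norm_snd_le (f : JetSup w₀ w₁ D) : ‖snd f‖ ≤ ‖f‖ := le_max_right _ _

/-- `‖f‖ ≤ r` iff both sizes are `≤ r`. [cite: Balaban1985Variational, (115) p.294] -/
theorem norm_le_iff {f : JetSup w₀ w₁ D} {r : ℝ} : ‖f‖ ≤ r ↔ ‖fst f‖ ≤ r ∧ ‖snd f‖ ≤ r := max_le_iff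

/-- `‖f‖ < r` iff both sizes are `< r`. [cite: Balaban1985Variational, (115) p.294] -/
theorem norm_lt_iff {f : JetSup w₀ w₁ D} {r : ℝ} : ‖f‖ < r ↔ ‖fst f‖ < r ∧ ‖snd f‖ < r := max_lt_iff

/-- **(115) read pointwise**: `max{|f|_{w₀}, |∇f|_{w₁}} < r` iff `w₀(x)‖f(x)‖ < r` at every `x` AND `w₁(p)‖(∇f)(p)‖ < r` at every
`p` (`0 < r`). [cite: Balaban1985Variational, (115) p.294, (77) p.290] -/
theorem norm_lt_iff_pointwise {f : JetSup w₀ w₁ D} {r : ℝ} (hr : 0 < r) :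
    ‖f‖ < r ↔ (∀ i, w₀ i * ‖JetSup.equiv w₀ w₁ D f i‖ < r) ∧ ∀ k, w₁ k * ‖D (JetSup.equiv w₀ w₁ D f) k‖ < r := by
  rw [norm_lt_iff, NegSup.norm_lt_iff hr, NegSup.norm_lt_iff hr]
  rfl

/-- The `≤` form of the pointwise reading (`0 ≤ r`). [cite: Balaban1985Variational, (115) p.294] -/
theorem norm_le_iff_pointwise {f : JetSup w₀ w₁ D} {r : ℝ} (hr : 0 ≤ r) :
    ‖f‖ ≤ r ↔ (∀ i, w₀ i * ‖JetSup.equiv w₀ w₁ D f i‖ ≤ r) ∧ ∀ k, w₁ k * ‖D (JetSup.equiv w₀ w₁ D f) k‖ ≤ r := by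
  rw [norm_le_iff, NegSup.norm_le_iff hr, NegSup.norm_le_iff hr]
  rfl

/-- `w₀(x)·‖f(x)‖ ≤ ‖f‖`. [cite: Balaban1985Variational, (115) p.294] -/
theorem weight_mul_norm_apply_le (f : JetSup w₀ w₁ D) (i : ι) : w₀ i * ‖JetSup.equiv w₀ w₁ D f i‖ ≤ ‖f‖ :=
  (NegSup.weight_mul_norm_apply_le (fst f) i).trans (norm_fst_le f)

/-- `w₁(p)·‖(∇f)(p)‖ ≤ ‖f‖`. [cite: Balaban1985Variational, (115) p.294] -/
theorem weight_mul_norm_deriv_le (f : JetSup w₀ w₁ D) (k : κ) : w₁ k * ‖D (JetSup.equiv w₀ w₁ D f) k‖ ≤ ‖f‖ :=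
  (NegSup.weight_mul_norm_apply_le (snd f) k).trans (norm_snd_le f)

/-- The zeroth-order part as a continuous linear map of norm `≤ 1` into `|·|_{w₀}`. [folklore] -/
def fstCLM (w₀ : ι → ℝ) (w₁ : κ → ℝ) (D : (ι → V) →ₗ[𝕜] (κ → V)) [Fact (∀ i, 0 < w₀ i)] [Fact (∀ k, 0 < w₁ k)] :
    JetSup w₀ w₁ D →L[𝕜] NegSup w₀ V :=
  LinearMap.mkContinuous ({ toFun := fst, map_add' := fst_add, map_smul' := fst_smul } : JetSup w₀ w₁ D →ₗ[𝕜] NegSup w₀ V) 1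
    fun f => by rw [one_mul]; exact norm_fst_le f

/-- The first-order part `f ↦ ∇f` as a continuous linear map of norm `≤ 1` into `|·|_{w₁}`. [folklore] -/
def sndCLM (w₀ : ι → ℝ) (w₁ : κ → ℝ) (D : (ι → V) →ₗ[𝕜] (κ → V)) [Fact (∀ i, 0 < w₀ i)] [Fact (∀ k, 0 < w₁ k)] :
    JetSup w₀ w₁ D →L[𝕜] NegSup w₁ V :=
  LinearMap.mkContinuous ({ toFun := snd, map_add' := snd_add, map_smul' := snd_smul } : JetSup w₀ w₁ D →ₗ[𝕜] NegSup w₁ V) 1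
    fun f => by rw [one_mul]; exact norm_snd_le f

/-- Unfolding `fstCLM`. [cite: Balaban1985Variational, (115) p.294] -/
@[simp] theorem fstCLM_apply (f : JetSup w₀ w₁ D) : fstCLM w₀ w₁ D f = fst f := rfl

/-- Unfolding `sndCLM`. [cite: Balaban1985Variational, (115) p.294] -/
@[simp] theorem sndCLM_apply (f : JetSup w₀ w₁ D) : sndCLM w₀ w₁ D f = snd f := rfl

/-- Evaluation at a point is a continuous linear map. [folklore] -/
def evalCLM (w₀ : ι → ℝ) (w₁ : κ → ℝ) (D : (ι → V) →ₗ[𝕜] (κ → V)) [Fact (∀ i, 0 < w₀ i)] [Fact (∀ k, 0 < w₁ k)] (i : ι) :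
    JetSup w₀ w₁ D →L[𝕜] V :=
  (NegSup.evalCLM 𝕜 w₀ i).comp (fstCLM w₀ w₁ D)

/-- Unfolding the evaluation map. [cite: Balaban1985Variational, (115) p.294] -/
@[simp] theorem evalCLM_apply (i : ι) (f : JetSup w₀ w₁ D) : evalCLM w₀ w₁ D i f = JetSup.equiv w₀ w₁ D f i := rfl

end JetSup

end JetSup

/-! ## §3 The printed letters: weights `(L^jη)^n` from a level map, the sizes `|·|_{(−n)}` and the space (115) -/

section Printed

variable {ι κ : Type*}

/-- The weight `(L^{j(x)}η)^n` of the size `|·|_{(−n)}` at a point of level `j(x)` (p. 286 *«sup_j L^jη sup_{Ω_j}|A′| = |A′|_{(−1)}»*). [cite: Balaban1985Variational, p.286] -/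
def levWeight (L η : ℝ) (lev : ι → ℕ) (n : ℕ) (x : ι) : ℝ := (L ^ lev x * η) ^ n

/-- Unfolding the weight. [cite: Balaban1985Variational, (115) p.294, p.286] -/
theorem levWeight_apply (L η : ℝ) (lev : ι → ℕ) (n : ℕ) (x : ι) : levWeight L η lev n x = (L ^ lev x * η) ^ n := rfl

/-- The weights `(L^jη)^n` are positive (`L, η > 0`). [cite: Balaban1985Variational, (115) p.294, p.286] -/
theorem levWeight_pos {L η : ℝ} (hL : 0 < L) (hη : 0 < η) (lev : ι → ℕ) (n : ℕ) (x : ι) : 0 < levWeight L η lev n x :=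
  pow_pos (mul_pos (pow_pos hL _) hη) n

/-- Positivity of the weights as a `Fact` instance (so that the sizes `|·|_{(−n)}` and (115) are normed spaces by §1–§2). [folklore] -/
instance levWeight.instFact {L η : ℝ} [hL : Fact (0 < L)] [hη : Fact (0 < η)] {lev : ι → ℕ} {n : ℕ} :
    Fact (∀ x, 0 < levWeight L η lev n x) :=
  ⟨levWeight_pos hL.out hη.out lev n⟩

/-- **The size `|·|_{(−n)}`** as a normed space: functions `ι → V` normed by `sup_x (L^{j(x)}η)^n ‖f(x)‖`. [cite: Balaban1985Variational, p.286, (98) p.293] -/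
abbrev NegSize (L η : ℝ) (lev : ι → ℕ) (n : ℕ) (V : Type*) : Type _ := NegSup (levWeight L η lev n) V

/-- **The space (115)** `max{|A|_{(−1)}, |∇A|_{(−2)}}` as a normed space, for a linear `∇ : (ι → V) →ₗ[𝕜] (κ → V)` (print: the covariant
derivative of the background; a PARAMETER here) and level maps on the points of `A` and of `∇A`. [cite: Balaban1985Variational, (115) p.294] -/
abbrev Space115 {𝕜 : Type*} [NontriviallyNormedField 𝕜] {V : Type*} [NormedAddCommGroup V] [NormedSpace 𝕜 V] (L η : ℝ)
    (lev₀ : ι → ℕ) (lev₁ : κ → ℕ) (D : (ι → V) →ₗ[𝕜] (κ → V)) : Type _ :=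
  JetSup (levWeight L η lev₀ 1) (levWeight L η lev₁ 2) D

/-! ### The level map of a domain sequence -/

section LevOf

open Classical in
/-- **The level `j(x)` of a point** for a sequence of domains `Ω₀ ⊃ Ω₁ ⊃ … ⊃ Ω_k`: the largest `j ≤ k` with `x ∈ Ω_j` (so `x ∈ Λ_{j(x)} =
Ω_{j(x)} ∖ Ω_{j(x)+1}` for `j(x) < k`). [cite: Balaban1985Variational, p.286, (3) p.278] -/
def levOf (Ω : ℕ → Set ι) (k : ℕ) (x : ι) : ℕ := Nat.findGreatest (fun j => x ∈ Ω j) k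

open Classical in
/-- The level is at most `k`. [cite: Balaban1985Variational, (115) p.294, p.286] -/
theorem levOf_le (Ω : ℕ → Set ι) (k : ℕ) (x : ι) : levOf Ω k x ≤ k := Nat.findGreatest_le k

open Classical in
/-- A point lies in the domain of its level (`Ω₀` = the whole lattice). [cite: Balaban1985Variational, (115) p.294, p.286] -/
theorem mem_levOf {Ω : ℕ → Set ι} (htop : ∀ x, x ∈ Ω 0) (k : ℕ) (x : ι) : x ∈ Ω (levOf Ω k x) :=
  Nat.findGreatest_spec (P := fun j => x ∈ Ω j) (Nat.zero_le k) (htop x)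

open Classical in
/-- Every domain containing the point has index at most the level. [cite: Balaban1985Variational, (115) p.294, p.286] -/
theorem le_levOf {Ω : ℕ → Set ι} {k j : ℕ} (hj : j ≤ k) {x : ι} (hx : x ∈ Ω j) : j ≤ levOf Ω k x :=
  Nat.le_findGreatest (P := fun j => x ∈ Ω j) hj hx

/-- The weights increase with the level (`1 ≤ L`, `0 ≤ η`). [cite: Balaban1985Variational, (115) p.294, p.286] -/
theorem levWeight_mono {L η : ℝ} (hL : 1 ≤ L) (hη : 0 ≤ η) {n j j' : ℕ} (hjj : j ≤ j') :
    (L ^ j * η) ^ n ≤ (L ^ j' * η) ^ n :=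
  pow_le_pow_left₀ (mul_nonneg (pow_nonneg (zero_le_one.trans hL) _) hη)
    (mul_le_mul_of_nonneg_right (pow_le_pow_right₀ hL hjj) hη) n

end LevOf

variable [Fintype ι] [Fintype κ] {𝕜 : Type*} [NontriviallyNormedField 𝕜] {V : Type*} [NormedAddCommGroup V] [NormedSpace 𝕜 V]

/-- **(115) verbatim**: `A₁` lies in the ball of radius `ε₄` of the space (115) iff `L^{j(x)}η·|A₁(x)| < ε₄` at every point and
`(L^{j(p)}η)²·|(∇A₁)(p)| < ε₄` at every derivative point. [cite: Balaban1985Variational, (115) p.294] -/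
theorem mem_ball115_iff {L η : ℝ} [Fact (0 < L)] [Fact (0 < η)] {lev₀ : ι → ℕ} {lev₁ : κ → ℕ} {D : (ι → V) →ₗ[𝕜] (κ → V)}
    {ε₄ : ℝ} (hε : 0 < ε₄) (A : Space115 L η lev₀ lev₁ D) :
    A ∈ ball (0 : Space115 L η lev₀ lev₁ D) ε₄ ↔
      (∀ x, L ^ lev₀ x * η * ‖JetSup.equiv _ _ D A x‖ < ε₄) ∧
        ∀ p, (L ^ lev₁ p * η) ^ 2 * ‖D (JetSup.equiv _ _ D A) p‖ < ε₄ := by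
  rw [mem_ball_zero_iff, JetSup.norm_lt_iff_pointwise hε]
  simp only [levWeight, pow_one]

/-- **(28)/(97)/(103) pointwise form of the size**: `|J|_{(−n)} < r` iff `(L^{j(x)}η)^n·|J(x)| < r` at every point. [cite: Balaban1985Variational, (28) p.282, (97) p.293, (103) p.293] -/
theorem mem_ballNeg_iff {L η : ℝ} [Fact (0 < L)] [Fact (0 < η)] {lev : ι → ℕ} {n : ℕ} {r : ℝ} (hr : 0 < r)
    (J : NegSize L η lev n V) :
    J ∈ ball (0 : NegSize L η lev n V) r ↔ ∀ x, (L ^ lev x * η) ^ n * ‖NegSup.equiv _ V J x‖ < r := by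
  rw [mem_ball_zero_iff, NegSup.norm_lt_iff hr]
  rfl

/-- From the size bound to the printed pointwise family *«on Ω_j»* ((97), (103), (28)): if `|f|_{(−n)} < r` then
`(L^{j(x)}η)^n·|f(x)| < r` at every point. [cite: Balaban1985Variational, (97) p.293, (103) p.293] -/
theorem pointwise_lt_of_norm_lt {L η : ℝ} [Fact (0 < L)] [Fact (0 < η)] {lev : ι → ℕ} {n : ℕ} {r : ℝ} (hr : 0 < r)
    {f : NegSize L η lev n V} (h : ‖f‖ < r) (x : ι) : (L ^ lev x * η) ^ n * ‖NegSup.equiv _ V f x‖ < r :=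
  (NegSup.norm_lt_iff hr).1 h x

/-! ### The verbatim form `sup_j (L^jη)^n sup_{Ω_j}` of p. 286 -/

/-- **p. 286 verbatim**: for a domain sequence `Ω₀ = T, Ω₁, …, Ω_k` and the level map `j(x)` it defines (the largest `j ≤ k` with
`x ∈ Ω_j`), the size `|f|_{(−n)} = sup_x (L^{j(x)}η)^n |f(x)|` is `≤ r` iff `(L^jη)^n |f(x)| ≤ r` for EVERY `j ≤ k` and every `x ∈ Ω_j` —
i.e. it IS *«sup_j (L^jη)^n sup_{Ω_j} |f|»* (`1 ≤ L`, `0 < η`, `0 ≤ r`; no nesting of the `Ω_j` is needed for this). [cite: Balaban1985Variational, p.286] -/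
theorem norm_le_iff_levels {L η : ℝ} [Fact (0 < L)] [Fact (0 < η)] (hL : 1 ≤ L) {Ω : ℕ → Set ι} {k : ℕ}
    (htop : ∀ x, x ∈ Ω 0) {n : ℕ} {r : ℝ} (hr : 0 ≤ r)
    (f : NegSize L η (levOf Ω k) n V) :
    ‖f‖ ≤ r ↔ ∀ j ≤ k, ∀ x ∈ Ω j, (L ^ j * η) ^ n * ‖NegSup.equiv _ V f x‖ ≤ r := by
  have hη : 0 ≤ η := (Fact.out : 0 < η).le
  rw [NegSup.norm_le_iff hr]
  constructor
  · intro h j hj x hx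
    exact (mul_le_mul_of_nonneg_right (levWeight_mono hL hη (le_levOf hj hx)) (norm_nonneg _)).trans (h x)
  · intro h x
    exact h (levOf Ω k x) (levOf_le Ω k x) x (mem_levOf htop k x)

/-- The strict form: `|f|_{(−n)} < r` iff `(L^jη)^n |f(x)| < r` for every `j ≤ k` and `x ∈ Ω_j` (`0 < r`) — (77)/(115) *«on Ω_j, j = 0, 1, …, k»* ⟺ the size bound. [cite: Balaban1985Variational, (77) p.290, (115) p.294] -/
theorem norm_lt_iff_levels {L η : ℝ} [Fact (0 < L)] [Fact (0 < η)] (hL : 1 ≤ L) {Ω : ℕ → Set ι} {k : ℕ}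
    (htop : ∀ x, x ∈ Ω 0) {n : ℕ} {r : ℝ} (hr : 0 < r) (f : NegSize L η (levOf Ω k) n V) :
    ‖f‖ < r ↔ ∀ j ≤ k, ∀ x ∈ Ω j, (L ^ j * η) ^ n * ‖NegSup.equiv _ V f x‖ < r := by
  have hη : 0 ≤ η := (Fact.out : 0 < η).le
  rw [NegSup.norm_lt_iff hr]
  constructor
  · intro h j hj x hx
    exact (mul_le_mul_of_nonneg_right (levWeight_mono hL hη (le_levOf hj hx)) (norm_nonneg _)).trans_lt (h x)
  · intro h x
    exact h (levOf Ω k x) (levOf_le Ω k x) x (mem_levOf htop k x)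

end Printed

/-! ## §4 The contraction scheme of Sect. E on the concrete carriers (SPECIALISATION of `B11Eq174Chart`; no new content) -/

section Chart

open B11Eq174Chart

variable {ι κ : Type*} [Fintype ι] [Fintype κ] {V : Type*} [NormedAddCommGroup V] [NormedSpace ℂ V] {L η : ℝ} [Fact (0 < L)]
  [Fact (0 < η)] {lev₀ : ι → ℕ} {lev₁ : κ → ℕ} {D : (ι → V) →ₗ[ℂ] (κ → V)}

/-- **The solution operator (116)/(175) of `B11Eq174Chart` ON THE CONCRETE CARRIERS** — configurations `𝔄`, `𝒜(𝔄)` in the space (115),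
currents `J` in `|·|_{(−3)}` on the same points, `𝒢 = 𝔊 : |·|_{(−3)} → (115)` continuous linear, `Λ` the optional linear term, `W = (δ/δA′)V`:
`solA115 𝒢 Λ W J ε₄ 𝔄 := B11Eq174Chart.solA 𝒢 Λ W J ε₄ 𝔄` with `𝒴 := Space115 L η lev₀ lev₁ ∇`, `𝒵 := NegSize L η lev₀ 3 V`. A specialisation:
every theorem of `B11Eq174Chart.Regime` applies to it verbatim. [cite: Balaban1985Variational, (116) p.295, (175) p.305] -/
abbrev solA115 (𝒢 : NegSize L η lev₀ 3 V →L[ℂ] Space115 L η lev₀ lev₁ D) (Λ : Space115 L η lev₀ lev₁ D →L[ℂ] Space115 L η lev₀ lev₁ D)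
    (W : Space115 L η lev₀ lev₁ D → NegSize L η lev₀ 3 V) (J : NegSize L η lev₀ 3 V) (ε₄ : ℝ) (𝔄 : Space115 L η lev₀ lev₁ D) :
    Space115 L η lev₀ lev₁ D :=
  solA 𝒢 Λ W J ε₄ 𝔄

/-- **The chart (174)/(179) `𝓗(B) = T(𝒜(H₁B) + H₁B)` of `B11Eq174Chart` ON THE CONCRETE CARRIERS**, the block fields `B` read in a
size `|·|_{(−0)} = sup|·|` space on their own index `β` (the bonds of `𝔅_k`; (20)/(75) `|B| < 2dLC₁ε₁`): `chartHB115 𝒢 Λ W J T ε₄ H₁ :=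
B11Eq174Chart.chartHB 𝒢 Λ W J T ε₄ H₁` with `𝒴 := Space115 …`, `𝒵 := NegSize … 3 V`, `𝒳 := NegSize L η levB 0 V`. A specialisation
(the consumer-side bundle `[NormedAddCommGroup] [NormedSpace ℂ] [CompleteSpace]` of the chart theorems is found by §1–§2's instances).
[cite: Balaban1985Variational, (174) p.305, Prop. 9 p.309] -/
abbrev chartHB115 {β : Type*} [Fintype β] {levB : β → ℕ} (𝒢 : NegSize L η lev₀ 3 V →L[ℂ] Space115 L η lev₀ lev₁ D)
    (Λ : Space115 L η lev₀ lev₁ D →L[ℂ] Space115 L η lev₀ lev₁ D) (W : Space115 L η lev₀ lev₁ D → NegSize L η lev₀ 3 V)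
    (J : NegSize L η lev₀ 3 V) (T : Space115 L η lev₀ lev₁ D → Space115 L η lev₀ lev₁ D) (ε₄ : ℝ)
    (H₁ : NegSize L η levB 0 V →L[ℂ] Space115 L η lev₀ lev₁ D) : NegSize L η levB 0 V → Space115 L η lev₀ lev₁ D :=
  chartHB 𝒢 Λ W J T ε₄ H₁

/-- **«𝓗(0) = 0» on the concrete carriers** (`B11Eq174Chart.Regime.chartH_zero` specialised; finite-dimensional fibre): under a regime,
`0 ≤ j`, `0 < a`, `T 0 = 0`, the chart vanishes at `B = 0`. [cite: Balaban1985Variational, Prop. 9 p.309] -/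
theorem chartHB115_zero [FiniteDimensional ℂ V] {β : Type*} [Fintype β] {levB : β → ℕ}
    {𝒢 : NegSize L η lev₀ 3 V →L[ℂ] Space115 L η lev₀ lev₁ D} {Λ : Space115 L η lev₀ lev₁ D →L[ℂ] Space115 L η lev₀ lev₁ D}
    {W : Space115 L η lev₀ lev₁ D → NegSize L η lev₀ 3 V} {B₀ θ C₄ a₃ j a ε₄ : ℝ} (R : Regime 𝒢 Λ W B₀ θ C₄ a₃ j a ε₄) (hj : 0 ≤ j)
    (ha : 0 < a) {T : Space115 L η lev₀ lev₁ D → Space115 L η lev₀ lev₁ D} (hT0 : T 0 = 0)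
    (H₁ : NegSize L η levB 0 V →L[ℂ] Space115 L η lev₀ lev₁ D) : chartHB115 𝒢 Λ W 0 T ε₄ H₁ 0 = 0 := by
  show chartH 𝒢 Λ W 0 T ε₄ (H₁ 0) = 0
  rw [map_zero]
  exact R.chartH_zero hj ha hT0

/-- **Proposition 6's «This solution satisfies the bounds (115)» READ ON THE LATTICE**: under the scheme's regime on the concrete carriers
(finite-dimensional fibre `V = 𝔤ᶜ`, so the space (115) is complete), for data `|J|_{(−3)} ≤ j`, `‖𝔄‖ < a`, the solution `𝒜 = 𝒜(𝔄)` of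
(116)/(175) obeys `L^{j(x)}η·|𝒜(x)| ≤ ε₄` at every point and `(L^{j(p)}η)²·|(∇𝒜)(p)| ≤ ε₄` at every derivative point, and solves the
fixed-point equation. [cite: Balaban1985Variational, Prop. 6 p.295, (115) p.294] -/
theorem solA115_pointwise [FiniteDimensional ℂ V] {𝒢 : NegSize L η lev₀ 3 V →L[ℂ] Space115 L η lev₀ lev₁ D}
    {Λ : Space115 L η lev₀ lev₁ D →L[ℂ] Space115 L η lev₀ lev₁ D} {W : Space115 L η lev₀ lev₁ D → NegSize L η lev₀ 3 V}
    {B₀ θ C₄ a₃ j a ε₄ : ℝ} (R : Regime 𝒢 Λ W B₀ θ C₄ a₃ j a ε₄) {J : NegSize L η lev₀ 3 V} (hJ : ‖J‖ ≤ j)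
    {𝔄 : Space115 L η lev₀ lev₁ D} (h𝔄 : ‖𝔄‖ < a) :
    (∀ x, L ^ lev₀ x * η * ‖JetSup.equiv _ _ D (solA115 𝒢 Λ W J ε₄ 𝔄) x‖ ≤ ε₄) ∧
      (∀ p, (L ^ lev₁ p * η) ^ 2 * ‖D (JetSup.equiv _ _ D (solA115 𝒢 Λ W J ε₄ 𝔄)) p‖ ≤ ε₄) ∧
        B11Prop6Scheme.mapT 𝒢 Λ W J 𝔄 (solA115 𝒢 Λ W J ε₄ 𝔄) = solA115 𝒢 Λ W J ε₄ 𝔄 := by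
  obtain ⟨hle, hfix⟩ := R.solA_mem hJ h𝔄
  have h := (JetSup.norm_le_iff_pointwise R.ε₄_nonneg).1 hle
  simp only [levWeight, pow_one] at h
  exact ⟨h.1, h.2, hfix⟩

end Chart

end Literature.MathematicalPhysics.QuantumFieldTheory.Balaban1983to89.B11Eq115Space

end
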